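import Mathlib
import HarnessLib
import Summits.Ventures.LatticeQCDFlow.Scoring.DoeblinPowerTwoChainAgreement
import Summits.Ventures.LatticeQCDFlow.Scoring.AgreementTestPower

/-!
# The POWER of the two-chain A-versus-B agreement test: two independent MARKOV-CHAIN runs with
# batch-means error bars whose target means DIFFER (`π_A f_A ≠ π_B f_B`) agree "within `z σ_comb`"
# with probability tending to ZERO, from any initial laws

HONEST FRAMING: exact (Metropolis-corrected) sampling algorithms for lattice gauge theory;
figures of merit are autocorrelation/cost numbers at stated couplings and volumes; no
continuum-physics claim.

Venture `LatticeQCDFlow` (cell pub-lqcd), topic `Scoring`; FANOUT row 4 (`s0-u1-b`, rung S0-B: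
"A vs B within `1σ_comb`").  Row 8's `Scoring/DoeblinPowerTwoChainAgreement.lean` proved the SIZE
side of the criterion for two independent correlated runs — HMC, a Metropolis / heat-bath sweep,
the exact flow sampler's chain — under Doeblin powers `(nHit κ_X m_X)(z,·) ≥ ε_X ν_X`, from any
initial laws: when `π_A f_A = π_B f_B` the combined-error-bar z-statistic
`z_n = (f̄_A,n − f̄_B,mₙ)/√(σ̂²_A,n/n + σ̂²_B,mₙ/mₙ)` is asymptotically `N(0, 1)`
(`doeblinPower_twoChain_agreement_clt`; calibration `Scoring/DoeblinPowerTwoChainAgreementCoverage`),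
and listed the POWER as not claimed.  This file supplies it by composing row 8's one-arm package
`doeblinPower_arm_clt_and_errorBar` (`√n (f̄_n − π f) ⇒ √σ²_f · Z` and `n·(σ̂²_n/n) → σ²_f` in
probability, any start) with row 4's abstract power theorem
`Scoring/AgreementTestPower.twoSample_agreement_power`: if the two target means differ then for
every window `z`, `(P^A_{μ_A} ⊗ P^B_{μ_B}){|z_n| ≤ z} → 0` — the criterion detects any fixed
discrepancy of the two codes' target means with probability tending to one, whatever the ratio of
run lengths (`mₙ → ∞` arbitrary) and whatever the two initial laws.  Only arm `A` needs a positive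
asymptotic variance (it pins the scale of the pooled error bar away from a degenerate `0/0`); arm
`B`'s asymptotic variance is merely non-negative, which holds under its Doeblin power
(`Scoring/DoeblinPowerBatchMeans.greenKubo_nonneg_of_nHit`).  NEW WORK of the cell; no definition;
nothing cited as a fact.  Printed counterparts NAMED ONLY: consistency of two-sample z-tests with
consistent variance estimators (folklore).

## Content

* `replicaSEsq_nonneg` — the between-replica squared standard error is `≥ 0` (every `R`);
* `batchMeans_errorBar_nonneg` — hence the batch-means squared standard error `σ̂²_n/n ≥ 0`;
* **`doeblinPower_twoChain_agreement_power`** — `π_A f_A ≠ π_B f_B` ⇒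
  `(P^A_{μ_A} ⊗ P^B_{μ_B}){|z_n| ≤ z} → 0` for every `z`.

NOT CLAIMED: local alternatives / the power function; a rate; dependent arms; `σ²_A = 0`; any
`ε, m` of a concrete sampler; any number of ours.
-/

noncomputable section

namespace Summit.Ventures.LatticeQCDFlow.Scoring

open MeasureTheory ProbabilityTheory Filter Finset Preorder
open scoped ENNReal Topology

section Nonneg

variable {Ω : Type*}

/-- **The between-replica squared standard error is non-negative** for every number of replicas
`R` (for `R ≤ 1` it is the documented junk value `x/0 = 0`). [ours] -/
theorem replicaSEsq_nonneg (Y : ℕ → Ω → ℝ) (R : ℕ) (ω : Ω) : 0 ≤ replicaSEsq Y R ω := by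
  unfold replicaSEsq
  rcases Nat.eq_zero_or_pos R with hR | hR
  · subst hR; simp
  · have h1 : (1 : ℝ) ≤ R := by exact_mod_cast hR
    exact div_nonneg (Finset.sum_nonneg fun r _ => sq_nonneg _)
      (mul_nonneg (Nat.cast_nonneg _) (by linarith))

/-- **The batch-means squared standard error `σ̂²_n/n = (b a · SE²_BM)/n` is non-negative.** [ours] -/
theorem batchMeans_errorBar_nonneg (f : Ω → ℝ) (a b n : ℕ) (x : ℕ → Ω) :
    0 ≤ (((b * a : ℕ) : ℝ) * replicaSEsq (fun j (x : ℕ → Ω) =>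
          (∑ i ∈ Finset.range b, f (x (b * j + i))) / b) a x) / n :=
  div_nonneg (mul_nonneg (Nat.cast_nonneg _) (replicaSEsq_nonneg _ _ _)) (Nat.cast_nonneg _)

end Nonneg

section TwoChains

variable {ΩA : Type*} [MeasurableSpace ΩA] {κA : Kernel ΩA ΩA} [IsMarkovKernel κA]
  {νA : Measure ΩA} [IsProbabilityMeasure νA] {εA : ℝ≥0∞} {mA : ℕ}
variable {ΩB : Type*} [MeasurableSpace ΩB] {κB : Kernel ΩB ΩB} [IsMarkovKernel κB]
  {νB : Measure ΩB} [IsProbabilityMeasure νB] {εB : ℝ≥0∞} {mB : ℕ}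

/-- **THE TWO-CHAIN AGREEMENT TEST HAS POWER TENDING TO ONE, FROM ANY INITIAL LAWS.**  Two
independent runs: chain `A` (`π_A` invariant, `(nHit κ_A m_A)(z,·) ≥ ε_A ν_A`, `0 < ε_A ≤ 1`,
`0 < m_A`, `|f_A| ≤ C_A` measurable, `σ²_A > 0`, batches `a_A(n), b_A(n) → ∞`, initial law `μ_A`) and
chain `B` likewise (no sign condition on `σ²_B`), read along any `mₙ → ∞`; target means DIFFERENT,
`π_A f_A ≠ π_B f_B`.  Then for every `z`, on the product of the two path laws:
`P{|(f̄_A,n − f̄_B,mₙ) / √(σ̂²_A,n/n + σ̂²_B,mₙ/mₙ)| ≤ z} → 0`. [ours] -/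
theorem doeblinPower_twoChain_agreement_power
    {πA : Measure ΩA} [IsProbabilityMeasure πA] (hπA : Kernel.Invariant κA πA)
    (hminA : ∀ z, εA • νA ≤ Exactness.nHit κA mA z) (hεA0 : 0 < εA) (hεA1 : εA ≤ 1) (hmA : 0 < mA)
    {fA : ΩA → ℝ} (hfA : Measurable fA) {CA : ℝ} (hCA : ∀ x, |fA x| ≤ CA)
    (hσA : 0 < ((∫ y, (fA y - ∫ z, fA z ∂πA) ^ 2 ∂πA)
            + 2 * ∑' k, ∫ y, (fA y - ∫ z, fA z ∂πA)
              * (kop κA)^[k + 1] (fun y => fA y - ∫ z, fA z ∂πA) y ∂πA))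
    (μA : Measure ΩA) [IsProbabilityMeasure μA] {aA bA : ℕ → ℕ} (haA : Tendsto aA atTop atTop)
    (hbA : Tendsto bA atTop atTop)
    [IsProbabilityMeasure (Kernel.trajMeasure (X := fun _ : ℕ => ΩA) μA
          (fun n : ℕ => κA.comap
            (fun h : (i : ↥(Finset.Iic n)) → ΩA => h ⟨n, Finset.mem_Iic.2 le_rfl⟩)
            (measurable_pi_apply _)))]
    {πB : Measure ΩB} [IsProbabilityMeasure πB] (hπB : Kernel.Invariant κB πB)
    (hminB : ∀ z, εB • νB ≤ Exactness.nHit κB mB z) (hεB0 : 0 < εB) (hεB1 : εB ≤ 1) (hmB : 0 < mB)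
    {fB : ΩB → ℝ} (hfB : Measurable fB) {CB : ℝ} (hCB : ∀ x, |fB x| ≤ CB)
    (μB : Measure ΩB) [IsProbabilityMeasure μB] {aB bB : ℕ → ℕ} (haB : Tendsto aB atTop atTop)
    (hbB : Tendsto bB atTop atTop)
    [IsProbabilityMeasure (Kernel.trajMeasure (X := fun _ : ℕ => ΩB) μB
          (fun n : ℕ => κB.comap
            (fun h : (i : ↥(Finset.Iic n)) → ΩB => h ⟨n, Finset.mem_Iic.2 le_rfl⟩)
            (measurable_pi_apply _)))]
    (hne : ∫ z, fA z ∂πA ≠ ∫ z, fB z ∂πB) {m : ℕ → ℕ} (hm : Tendsto m atTop atTop) (z : ℝ) :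
    Tendsto (fun n => ((Kernel.trajMeasure (X := fun _ : ℕ => ΩA) μA
          (fun n : ℕ => κA.comap
            (fun h : (i : ↥(Finset.Iic n)) → ΩA => h ⟨n, Finset.mem_Iic.2 le_rfl⟩)
            (measurable_pi_apply _))).prod
        (Kernel.trajMeasure (X := fun _ : ℕ => ΩB) μB
          (fun n : ℕ => κB.comap
            (fun h : (i : ↥(Finset.Iic n)) → ΩB => h ⟨n, Finset.mem_Iic.2 le_rfl⟩)
            (measurable_pi_apply _)))).real
        {ω : (ℕ → ΩA) × (ℕ → ΩB) |
          |((∑ t ∈ Finset.range n, fA (ω.1 t)) / n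
              - (∑ t ∈ Finset.range (m n), fB (ω.2 t)) / (m n))
            / Real.sqrt ((((bA n * aA n : ℕ) : ℝ) * replicaSEsq (fun j (x : ℕ → ΩA) =>
                (∑ i ∈ Finset.range (bA n), fA (x (bA n * j + i))) / (bA n)) (aA n) ω.1) / n
              + (((bB (m n) * aB (m n) : ℕ) : ℝ) * replicaSEsq (fun j (x : ℕ → ΩB) =>
                (∑ i ∈ Finset.range (bB (m n)), fB (x (bB (m n) * j + i)))
                / (bB (m n))) (aB (m n)) ω.2) / (m n))| ≤ z}) atTop (𝓝 0) := by
  -- a standard normal variable on some auxiliary probability space (the limit laws live there)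
  have hZ : HasLaw (fun x : ℝ => x) (gaussianReal 0 1) (gaussianReal 0 1) :=
    ⟨aemeasurable_id, Measure.map_id⟩
  have hσB : 0 ≤ ((∫ y, (fB y - ∫ z, fB z ∂πB) ^ 2 ∂πB)
            + 2 * ∑' k, ∫ y, (fB y - ∫ z, fB z ∂πB)
              * (kop κB)^[k + 1] (fun y => fB y - ∫ z, fB z ∂πB) y ∂πB) :=
    greenKubo_nonneg_of_nHit hπB (Exactness.GeneralNCMC.minorised_setwise hminB) hεB0 hεB1 hmB
      hfB hCB
  obtain ⟨hcltA, hVA⟩ := doeblinPower_arm_clt_and_errorBar hπA hminA hεA0 hεA1 hmA hfA hCA hσA.le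
    μA haA hbA hZ
  obtain ⟨hcltB, hVB⟩ := doeblinPower_arm_clt_and_errorBar hπB hminB hεB0 hεB1 hmB hfB hCB hσB
    μB haB hbB hZ
  exact CardConsistency.twoSample_agreement_power hne hσA
    (fun n x => batchMeans_errorBar_nonneg fA (aA n) (bA n) n x)
    (fun n x => batchMeans_errorBar_nonneg fB (aB n) (bB n) n x) hcltA hcltB hVA hVB hm z

end TwoChains

end Summit.Ventures.LatticeQCDFlow.Scoring

end
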